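import Summits.CriticalPhenomena.PercolationContinuityZ3.Theorems.PercNearOneGluingNoHeavyLowerTailAntitheticCycleOplus
import Summits.CriticalPhenomena.PercolationContinuityZ3.Theorems.PercNearOneGluingNoHeavyLowerTailAntitheticCycleTII
import Summits.CriticalPhenomena.PercolationContinuityZ3.Theorems.PercNearOneGluingNoHeavyLowerTailAntitheticPendantArms
import Summits.CriticalPhenomena.PercolationContinuityZ3.Theorems.PercNearOneGluingNoHeavyLowerTailAntitheticDegTwoOneSided
import HarnessLib

/-!
# `NoHeavyLowerTail` (stmt-CriticalPhenomena-4575) — antithetic cluster pairs: **THEOREM Θ** — CONJECTURE Δ2 / the vertex antithetic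
# inequality at `R = {x}` for a CYCLE THROUGH THE SOURCE PLUS ONE HANDLE THROUGH `x` (HOME/THEOREM-Theta.md §3, prim-hp-2 gen 62)

Support file (`--supports stmt-CriticalPhenomena-4575`, hull-port prover `prim-hp-2`, gen 62).  No definitions, no named facts, no sorries;
standard axioms.  VERTEX version (functions of the vertex clusters `X = openCluster (ω ∩ E) s`, `Y = openCluster (ωᶜ ∩ E) s`).

SETTING.  A cycle `v 0 = s, v 1, …, v (n-1)` (`n ≥ 3`, …AntitheticCycleRuns), two cycle vertices `P = v p`, `Q = v q` (`0 < p, q < n`, `P = Q`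
allowed), a `y`-ARM `u 0 = P, u 1, …, u a = y` and a `z`-ARM `w 0 = Q, w 1, …, w b = z` of fresh vertices (pairs `Cyc.edgeSet a u`, `Cyc.edgeSet b w`;
`a = 0` or `b = 0` allowed), `H = cycle ∪ arms`, and a new vertex `x` joined to `y` and `z`: `G = H + xy + xz` = the cycle with the HANDLE
`P – … – y – x – z – … – Q`; `R = {x}`.

* `Antithetic.Cyc.handle_termTwo_nonneg`: for every super-odd twisted-monotone pair `K₁, K₂`,
  `0 ≤ Σ_{ω : y ∈ X_H ω, z ∉ Y_H ω} K₁(X_H ω, Y_H ω)·K₂(X_H ω, Y_H ω)` — TERM II of the deg-2 elimination at `x` is nonnegative.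
  PROOF = the chain of HOME/THEOREM-Theta.md §3: peel the `y`-arm (PR1, `Pendant.termTwo_path_nonneg`), peel the `z`-arm (PR2,
  `Pendant.termTwo_stub_nonneg`) at the price of THEOREM ⊕-CYCLE for the cycle with the remaining stub (`Cyc.oplus_cycle_stub`), and finish
  with PR4 on the bare cycle (`Cyc.termTwo_cycle_nonneg`).
* **`Antithetic.Cyc.handle_vertex_sum_nonneg` (THEOREM Θ)**: for all monotone `F, G : Set V → ℝ`,
  `0 ≤ Σ_{ω : ¬(x ∈ X_G ω ∧ x ∈ Y_G ω)} (F(X_G ω) − F(Y_G ω))·(G(X_G ω) − G(Y_G ω))`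
  (`DegTwo.deg2_vertex_of_termTwo`: TERM I by block freezing, TERM II above).  With arms of length `≥ 1` this is the first NON-CUT class of
  CONJECTURE Δ2 beyond the bare cycle (THEOREM C′, …AntitheticCyclePlusChange, is the handle of length 2); cut composites are THEOREM 2T
  (…AntitheticTwoStageFreeEdge).
[cite: VandenbergHaggstromKahn2005, §1 p. 6 ("Harris' inequality"), §1 p. 3 (open cluster `C_s`)]
-/

noncomputable section

namespace Summit.CriticalPhenomena.PercolationContinuityZ3.Theorems

open Literature.Probability.Percolation
open scoped Classical

namespace Antithetic

namespace Cyc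

variable {V : Type*} [Fintype V] {n : ℕ} {v : ℕ → V} (hn : 3 ≤ n) (hinj : ∀ i j, i < n → j < n → v i = v j → i = j) (hper : v n = v 0)
include hn hinj hper

omit [Fintype V] in
/-- A cycle vertex `v i` is not one of the fresh vertices `w k`, `k ≥ 1`, of a pendant arm. -/
theorem v_ne_arm {w : ℕ → V} {b : ℕ} (hwfresh : ∀ i, 0 < i → i ≤ b → ∀ f ∈ edgeSet n v, w i ∈ f → f.IsDiag)
    {i : ℕ} (hi : i < n) {k : ℕ} (hk0 : 0 < k) (hkb : k ≤ b) : v i ≠ w k := by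
  intro h
  have hd := hwfresh k hk0 hkb (edge v i) ⟨i, hi, rfl⟩ (by rw [← h]; exact Sym2.mem_mk_left _ _)
  rw [edge, Sym2.mk_isDiag_iff] at hd
  exact v_ne_succ hn hinj hper hi hd

omit [Fintype V] hn hinj hper in
/-- The end `w b` of a pendant arm is not one of the fresh vertices `u k`, `k ≥ 1`, of a second arm avoiding it. -/
theorem end_ne_arm {u w : ℕ → V} {a b : ℕ} {E : Set (Sym2 V)}
    (hufresh : ∀ i, 0 < i → i ≤ a → ∀ f ∈ E ∪ edgeSet b w, u i ∈ f → f.IsDiag)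
    (hwinj : ∀ i j, i ≤ b → j ≤ b → w i = w j → i = j) (hw0 : ∀ k, 0 < k → k ≤ a → w 0 ≠ u k)
    {k : ℕ} (hk0 : 0 < k) (hka : k ≤ a) : w b ≠ u k := by
  by_cases hb : b = 0
  · rw [hb]; exact hw0 k hk0 hka
  · intro h
    have hd := hufresh k hk0 hka (edge w (b - 1)) (Or.inr ⟨b - 1, by omega, rfl⟩)
      (by rw [← h, edge, show b - 1 + 1 = b by omega]; exact Sym2.mem_mk_right _ _)
    rw [edge, Sym2.mk_isDiag_iff, show b - 1 + 1 = b by omega] at hd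
    exact absurd (hwinj (b - 1) b (by omega) le_rfl hd) (by omega)

omit [Fintype V] in
/-- The pairs of the handle graph `H` (cycle and two arms of pairwise distinct consecutive vertices) are not loops. -/
theorem not_isDiag_of_mem {u w : ℕ → V} {a b : ℕ} (huinj : ∀ i j, i ≤ a → j ≤ a → u i = u j → i = j)
    (hwinj : ∀ i j, i ≤ b → j ≤ b → w i = w j → i = j) {f : Sym2 V} (hf : f ∈ (edgeSet n v ∪ edgeSet b w) ∪ edgeSet a u) :
    ¬ f.IsDiag := by
  rcases hf with (⟨i, hi, rfl⟩ | ⟨i, hi, rfl⟩) | ⟨i, hi, rfl⟩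
  · rw [edge, Sym2.mk_isDiag_iff]; exact v_ne_succ hn hinj hper hi
  · rw [edge, Sym2.mk_isDiag_iff]; exact fun h => absurd (hwinj i (i + 1) (by omega) (by omega) h) (by omega)
  · rw [edge, Sym2.mk_isDiag_iff]; exact fun h => absurd (huinj i (i + 1) (by omega) (by omega) h) (by omega)

variable {p q : ℕ} (hp0 : 0 < p) (hpn : p < n) (hq0 : 0 < q) (hqn : q < n)
  {u w : ℕ → V} {a b : ℕ} (hu0 : u 0 = v p) (hw0 : w 0 = v q)
  (hufresh : ∀ i, 0 < i → i ≤ a → ∀ f ∈ edgeSet n v ∪ edgeSet b w, u i ∈ f → f.IsDiag)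
  (hwfresh : ∀ i, 0 < i → i ≤ b → ∀ f ∈ edgeSet n v, w i ∈ f → f.IsDiag)
  (huinj : ∀ i j, i ≤ a → j ≤ a → u i = u j → i = j) (hwinj : ∀ i j, i ≤ b → j ≤ b → w i = w j → i = j)
include hp0 hpn hq0 hqn hu0 hw0 hufresh hwfresh huinj hwinj

/-- **TERM II for the handle graph** (HOME/THEOREM-Theta.md §3): with `H` = cycle ∪ `y`-arm ∪ `z`-arm (edge set
`(Cyc.edgeSet n v ∪ Cyc.edgeSet b w) ∪ Cyc.edgeSet a u`), for every super-odd twisted-monotone pair `K₁, K₂`,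
`0 ≤ Σ_{ω : y ∈ X_H ω, z ∉ Y_H ω} K₁(X_H ω, Y_H ω)·K₂(X_H ω, Y_H ω)`. [this work] -/
theorem handle_termTwo_nonneg (K₁ K₂ : Set V → Set V → ℝ)
    (hK₁ : ∀ ⦃P P' Q Q' : Set V⦄, P ⊆ P' → Q' ⊆ Q → K₁ P Q ≤ K₁ P' Q') (hso₁ : ∀ P Q, 0 ≤ K₁ P Q + K₁ Q P)
    (hK₂ : ∀ ⦃P P' Q Q' : Set V⦄, P ⊆ P' → Q' ⊆ Q → K₂ P Q ≤ K₂ P' Q') (hso₂ : ∀ P Q, 0 ≤ K₂ P Q + K₂ Q P) :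
    0 ≤ ∑ ω ∈ Finset.univ.filter (fun ω : Set (Sym2 V) =>
        u a ∈ openCluster (ω ∩ ((edgeSet n v ∪ edgeSet b w) ∪ edgeSet a u)) (v 0) ∧
          w b ∉ openCluster (ωᶜ ∩ ((edgeSet n v ∪ edgeSet b w) ∪ edgeSet a u)) (v 0)),
      K₁ (openCluster (ω ∩ ((edgeSet n v ∪ edgeSet b w) ∪ edgeSet a u)) (v 0))
          (openCluster (ωᶜ ∩ ((edgeSet n v ∪ edgeSet b w) ∪ edgeSet a u)) (v 0)) *
        K₂ (openCluster (ω ∩ ((edgeSet n v ∪ edgeSet b w) ∪ edgeSet a u)) (v 0))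
          (openCluster (ωᶜ ∩ ((edgeSet n v ∪ edgeSet b w) ∪ edgeSet a u)) (v 0)) := by
  have hufresh' : ∀ i, 0 < i → i ≤ a → ∀ f ∈ edgeSet n v, u i ∈ f → f.IsDiag :=
    fun i hi hia f hf => hufresh i hi hia f (Or.inl hf)
  have hsu : ∀ i, 0 < i → i ≤ a → v 0 ≠ u i := fun i hi hia => v_ne_arm hn hinj hper hufresh' (by omega) hi hia
  have hsw : ∀ i, 0 < i → i ≤ b → v 0 ≠ w i := fun i hi hib => v_ne_arm hn hinj hper hwfresh (by omega) hi hib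
  have hPw : ∀ i, 0 < i → i ≤ b → v p ≠ w i := fun i hi hib => v_ne_arm hn hinj hper hwfresh hpn hi hib
  have hzu : ∀ i, 0 < i → i ≤ a → w b ≠ u i :=
    fun i hi hia => end_ne_arm hufresh hwinj (fun k hk hka => by rw [hw0]; exact v_ne_arm hn hinj hper hufresh' hqn hk hka) hi hia
  -- peel the `y`-arm (PR1)
  refine Pendant.termTwo_path_nonneg hufresh huinj hsu hzu ?_ le_rfl K₁ K₂ hK₁ hso₁ hK₂ hso₂
  intro L₁ L₂ hL₁ hsoL₁ hL₂ hsoL₂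
  rw [hu0]
  -- peel the `z`-arm (PR2), paying THEOREM ⊕-CYCLE for each remaining stub, and finish with PR4 on the bare cycle
  refine Pendant.termTwo_stub_nonneg hwfresh hwinj hsw hPw ?_ ?_ le_rfl L₁ L₂ hL₁ hsoL₁ hL₂ hsoL₂
  · intro j hj M₁ M₂ hM₁ hsoM₁ hM₂ hsoM₂
    exact oplus_cycle_stub hn hinj hper hp0 hpn hwfresh hwinj hsw hPw hj.le M₁ M₂ hM₁ hsoM₁ hM₂ hsoM₂
  · intro M₁ M₂ hM₁ hsoM₁ hM₂ hsoM₂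
    rw [hw0]
    exact termTwo_cycle_nonneg hn hinj hper hp0 hpn hq0 hqn M₁ M₂ hM₁ hsoM₁ hM₂ hsoM₂

/-- **THEOREM Θ** (HOME/THEOREM-Theta.md §3): the vertex antithetic inequality at `R = {x}` for the cycle through `s` with one handle
`P – (y-arm) – y – x – z – (z-arm) – Q` through the fresh vertex `x` (`P = v p`, `Q = v q` cycle vertices other than `s`; arms of any lengths
with `yz` not a pair of `H`): with `E = H ∪ {xy, xz}`, for all monotone `F, G`,
`0 ≤ Σ_{ω : ¬(x ∈ X_E ω ∧ x ∈ Y_E ω)} (F(X_E ω) − F(Y_E ω))·(G(X_E ω) − G(Y_E ω))`. [this work] -/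
theorem handle_vertex_sum_nonneg {x : V} (hx : ∀ f ∈ (edgeSet n v ∪ edgeSet b w) ∪ edgeSet a u, x ∈ f → f.IsDiag)
    (hxs : x ≠ v 0) (hxy : x ≠ u a) (hxz : x ≠ w b) (hyz : u a ≠ w b) (hg : s(u a, w b) ∉ (edgeSet n v ∪ edgeSet b w) ∪ edgeSet a u)
    {F G : Set V → ℝ} (hF : Monotone F) (hG : Monotone G) :
    0 ≤ ∑ ω ∈ Finset.univ.filter (fun ω : Set (Sym2 V) =>
        ¬ ((openGraph (ω ∩ insert s(x, u a) (insert s(x, w b) ((edgeSet n v ∪ edgeSet b w) ∪ edgeSet a u)))).Reachable (v 0) x ∧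
          (openGraph (ωᶜ ∩ insert s(x, u a) (insert s(x, w b) ((edgeSet n v ∪ edgeSet b w) ∪ edgeSet a u)))).Reachable (v 0) x)),
      (F (openCluster (ω ∩ insert s(x, u a) (insert s(x, w b) ((edgeSet n v ∪ edgeSet b w) ∪ edgeSet a u))) (v 0)) -
          F (openCluster (ωᶜ ∩ insert s(x, u a) (insert s(x, w b) ((edgeSet n v ∪ edgeSet b w) ∪ edgeSet a u))) (v 0))) *
        (G (openCluster (ω ∩ insert s(x, u a) (insert s(x, w b) ((edgeSet n v ∪ edgeSet b w) ∪ edgeSet a u))) (v 0)) -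
          G (openCluster (ωᶜ ∩ insert s(x, u a) (insert s(x, w b) ((edgeSet n v ∪ edgeSet b w) ∪ edgeSet a u))) (v 0))) := by
  set EH := (edgeSet n v ∪ edgeSet b w) ∪ edgeSet a u with hEH
  have hnd : ∀ f ∈ EH, ¬ f.IsDiag := fun f hf => not_isDiag_of_mem hn hinj hper huinj hwinj hf
  have he' : s(x, u a) ∉ EH := fun h => absurd (hx _ h (Sym2.mem_mk_left _ _)) (hnd _ h)
  have hf' : s(x, w b) ∉ EH := fun h => absurd (hx _ h (Sym2.mem_mk_left _ _)) (hnd _ h)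
  have hE' : insert s(x, u a) (insert s(x, w b) EH) \ {s(x, u a), s(x, w b)} = EH := by
    ext f
    simp only [Set.mem_sdiff, Set.mem_insert_iff, Set.mem_singleton_iff, not_or]
    constructor
    · rintro ⟨h1 | h1 | h1, h2, h3⟩
      · exact absurd h1 h2
      · exact absurd h1 h3
      · exact h1
    · intro h
      exact ⟨Or.inr (Or.inr h), fun h1 => he' (h1 ▸ h), fun h1 => hf' (h1 ▸ h)⟩
  refine DegTwo.deg2_vertex_of_termTwo (E := insert s(x, u a) (insert s(x, w b) EH)) hxs hxy hxz hyz
    (Set.mem_insert _ _) (Set.mem_insert_of_mem _ (Set.mem_insert _ _)) ?_ ?_ hF hG ?_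
  · -- `x` meets only the two new pairs
    intro h hh hxh
    rcases hh with h1 | h1 | h1
    · exact Or.inl h1
    · exact Or.inr h1
    · exfalso
      exact hnd h h1 (hx h h1 hxh)
  · -- `yz` is not a pair
    intro h
    rcases h with h1 | h1 | h1
    · have := Sym2.eq_iff.1 h1
      rcases this with ⟨h2, -⟩ | ⟨-, h2⟩
      · exact hxy h2.symm
      · exact hxz h2.symm
    · have := Sym2.eq_iff.1 h1
      rcases this with ⟨h2, -⟩ | ⟨h2, -⟩
      · exact hxy h2.symm
      · exact hyz h2
    · exact hg h1
  · -- TERM II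
    rw [hE']
    have hK : ∀ {F : Set V → ℝ}, Monotone F →
        (∀ ⦃P P' Q Q' : Set V⦄, P ⊆ P' → Q' ⊆ Q → F (P ∪ {x}) - F Q ≤ F (P' ∪ {x}) - F Q') ∧
        (∀ P Q : Set V, 0 ≤ (F (P ∪ {x}) - F Q) + (F (Q ∪ {x}) - F P)) := by
      intro F hF
      refine ⟨fun P P' Q Q' hP hQ => sub_le_sub (hF (Set.union_subset_union_left _ hP)) (hF hQ), fun P Q => ?_⟩
      have h1 : F P ≤ F (P ∪ {x}) := hF Set.subset_union_left
      have h2 : F Q ≤ F (Q ∪ {x}) := hF Set.subset_union_left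
      linarith
    exact handle_termTwo_nonneg hn hinj hper hp0 hpn hq0 hqn hu0 hw0 hufresh hwfresh huinj hwinj
      (fun P Q => F (P ∪ {x}) - F Q) (fun P Q => G (P ∪ {x}) - G Q) (hK hF).1 (hK hF).2 (hK hG).1 (hK hG).2

end Cyc

end Antithetic

end Summit.CriticalPhenomena.PercolationContinuityZ3.Theorems
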